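import Summits.ResolutionOfSingularities.ResolutionOfSingularities.Theorems.EquisingularLiftEquisingularLiftNatTowerRoundFiveDefs
import HarnessLib

/-!
# Route `EquisingularLift`, crux EL♮ / EL♮(3) — NOSE-TOWER reach predicate, revision ₇: «the nose is a CURVE» restored as a genus-free clause
# — append-only successor of …NatTowerRoundFiveDefs (p595717)

res-L1-w45b-lead-2 g4 (lead, text owner), TWENTY-FIRST registered-text event, answering res-L1-w45b-stub-2 g9's STEP-0 text flag (STATUS
2026-08-28T02:10:01Z, FLAG 1): `ReachNoseTower₆` dropped the rational-nose clause `Nonempty (Z̃ ≅ ℙ¹_k)` WHOLESALE, including its genus-free shadow «`Z̃` is a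
curve» which the nose engine consumes (codimension 2 of the lifted first centre at the seed; 2-frames of every later round centre through `TowerFull`) and
which `IsLiftableNoseClass₂ k n Z ∧ Z.Infinite` does not give (class₂ disjoint unions may put isolated points next to a curve). Revision ₇ puts the shadow
back, in the V4 engine's own currency (…NatNoseTowerAssemblyV4 l.124–125): every CLOSED point of the reduced nose has a one-dimensional local ring.
OURS; planning vocabulary of the crux chain, not a statement of any manuscript ([Hironaka2017] is a candidate under adjudication, D-0012/D-0089, nothing of
it is asserted here); AI-written, weaker than expert review. Definition + one pure-logic lemma (no `sorry`, standard axioms).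
-/

set_option linter.dupNamespace false

noncomputable section

open CategoryTheory AlgebraicGeometry TopologicalSpace
open Literature.AlgebraicGeometry.Resolution
open AlgebraicGeometry.Scheme.IdealSheafData

namespace Summit.ResolutionOfSingularities.ResolutionOfSingularities.Cruxes.EquisingularLiftNat.Sections

/-- **NOSE-TOWER, revision ₇ — noses of any genus that ARE CURVES.** `ReachNoseTower₆` with the genus-free clause «every closed point of the reduced nose
`Z̃` has a local ring of Krull dimension `1`» (the V4 engine's `hcar₀`/`hdimZ` currency) inserted after `Z.Infinite`. Downstairs only.
[OURS · planning vocabulary] -/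
def ReachNoseTower₇ (k : Type) [Field k] (n : ℕ) (H : Scheme.{0})
    (ι : H ⟶ (Literature.AlgebraicGeometry.Motives.projectiveSpace n k).left) : Prop :=
  ∃ (Z : Set (Literature.AlgebraicGeometry.Motives.projectiveSpace n k).left) (hZ : IsClosed Z),
    IsLiftableNoseClass₂ k n Z ∧ Z ⊆ Set.range ι ∧ ¬ (Set.range ι ⊆ Z) ∧ Z.Infinite ∧
    (∀ z : ↥(redSub (Literature.AlgebraicGeometry.Motives.projectiveSpace n k).left Z hZ),
      IsClosed ({z} : Set ↥(redSub (Literature.AlgebraicGeometry.Motives.projectiveSpace n k).left Z hZ)) →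
        ringKrullDim ((redSub (Literature.AlgebraicGeometry.Motives.projectiveSpace n k).left Z hZ).presheaf.stalk z) =
          ((1 : ℕ) : WithBot ℕ∞)) ∧
    ∃ (F₂ : Scheme.{0}) (υ : F₂ ⟶ (Literature.AlgebraicGeometry.Motives.projectiveSpace n k).left),
      IsBlowup υ (Scheme.IdealSheafData.vanishingIdeal
        (⟨Z, hZ⟩ : Closeds (Literature.AlgebraicGeometry.Motives.projectiveSpace n k).left)) ∧
      ∃ (F' : Scheme.{0}) (γ' : F' ⟶ F₂) (T' E' K' : Set F'),
        (∀ R₁ : (∀ G : Scheme.{0}, (G ⟶ F₂) → Set G → Set G → Set G → Prop),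
          R₁ F₂ (𝟙 F₂) (closure (υ ⁻¹' (Set.range ι \ Z))) (υ ⁻¹' Z) ∅ →
          TowerPtReg₂ (Literature.AlgebraicGeometry.Motives.projectiveSpace n k).left F₂ υ R₁ →
          TowerPtRam₂ (Literature.AlgebraicGeometry.Motives.projectiveSpace n k).left F₂ υ R₁ →
          TowerRound₅ (Literature.AlgebraicGeometry.Motives.projectiveSpace n k).left F₂ υ Z hZ R₁ →
          R₁ F' γ' T' E' K') ∧
        Literature.AlgebraicGeometry.Resolution.Scheme.IsRegular (redSub F' (closure T') isClosed_closure)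

/-- **NOSE₇ ⊆ NOSE₆** (forgetful: drop the curve clause). [OURS · pure logic] -/
theorem reachNoseTower₆_of_reachNoseTower₇ (k : Type) [Field k] (n : ℕ) (H : Scheme.{0})
    (ι : H ⟶ (Literature.AlgebraicGeometry.Motives.projectiveSpace n k).left) (h : ReachNoseTower₇ k n H ι) :
    ReachNoseTower₆ k n H ι := by
  obtain ⟨Z, hZ, h1, h2, h3, h4, -, F₂, υ, hυ, F', γ', T', E', K', hcl, hreg⟩ := h
  exact ⟨Z, hZ, h1, h2, h3, h4, F₂, υ, hυ, F', γ', T', E', K', hcl, hreg⟩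

end Summit.ResolutionOfSingularities.ResolutionOfSingularities.Cruxes.EquisingularLiftNat.Sections

end
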